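import Mathlib

/-!
# Type I₂ dilated, line `peel-to-drappeau`: numerical lemmas for THE WINDOW step (`stub_window`)

Support file (theorem-only, Mathlib only) for `Summits/Parity/GeneralizedHardyLittlewood/Theorems/
LiouvilleShiftedTablesTypeI2DilatedWindow.lean` (`WindowStep : DilatedTypeIICore → DilatedTypeII`,
crux `TypeI2Dilated`, route `LiouvilleShiftedTables`, line `peel-to-drappeau`).  With the
parameters of the window separation — transition width `δ = x^{−4ρ₁}`, period `V = 4 log x`,
degree `H = ⌊x^{8ρ₁}⌋`, divisor-bound exponent `ε = ρ₁/4` — these are the explicit real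
inequalities used to bound the main part by `C₁' x^{1+5ρ}/Rd` and the error (strips + far error)
by `Kc x^{1+5ρ}/Rd`:

* §4 `window_far_error_le` (`1/(2(H+1)δ) ≤ δ/2`), `window_delta_le` (`δV ≤ 1`, `δ ≤ 1/4`),
  `window_bracket_le` (size of the error region `≤ 83456 x^{1−4ρ₁} log x`), `window_G_le`
  (the trivial-bound constant `A²U ≤ 3·1025·Ca^{2K} Cd² Rd x^{ρ₁}`), `window_log_price_le`
  (`2 + log(H+1) ≤ x^ρ`), `window_main_part_le`, `window_power_bookkeeping`
  (`Rd x^{ρ₁} x^{2ρ} x^{1−4ρ₁} log x ≤ x^{1+5ρ}/Rd`);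
* §5 `window_eventually` — the finitely many eventual-in-`x` inequalities, packaged.

No definitions, no named facts. [this line: peel-to-drappeau, stub_window]
-/

noncomputable section

namespace Summit.Parity.GeneralizedHardyLittlewood.Cruxes.TypeI2Dilated.PeelToDrappeau

open Finset Real

/-! ### §4 Numerical lemmas for the window step (small contexts) -/

/-- The far error of the smoothing: with `δ = x^{−4ρ₁}` and `H + 1 ≥ x^{8ρ₁}`,
`1/(2(H+1)δ) ≤ δ/2`. [folklore] -/
theorem window_far_error_le {x ρ₁ δ : ℝ} {H : ℕ} (hx0 : 0 < x) (hδ : δ = x ^ (-(4 * ρ₁)))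
    (hH1 : x ^ (8 * ρ₁) ≤ (H : ℝ) + 1) : 1 / (2 * ((H : ℝ) + 1) * δ) ≤ δ / 2 := by
  have hδpos : 0 < δ := by rw [hδ]; exact Real.rpow_pos_of_pos hx0 _
  have hx4ρ₁ : x ^ (4 * ρ₁) * δ = 1 := by
    rw [hδ, Real.rpow_neg hx0.le, mul_inv_cancel₀ (Real.rpow_pos_of_pos hx0 _).ne']
  rw [div_le_div_iff₀ (by positivity) (by norm_num : (0 : ℝ) < 2)]
  have h8 : x ^ (8 * ρ₁) = x ^ (4 * ρ₁) * x ^ (4 * ρ₁) := by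
    rw [← Real.rpow_add hx0]; ring_nf
  have h1 : 1 ≤ ((H : ℝ) + 1) * δ * δ := by
    calc (1 : ℝ) = (x ^ (4 * ρ₁) * δ) * (x ^ (4 * ρ₁) * δ) := by rw [hx4ρ₁, one_mul]
      _ = x ^ (8 * ρ₁) * δ * δ := by rw [h8]; ring
      _ ≤ ((H : ℝ) + 1) * δ * δ :=
          mul_le_mul_of_nonneg_right (mul_le_mul_of_nonneg_right hH1 hδpos.le) hδpos.le
  calc (1 : ℝ) * 2 ≤ ((H : ℝ) + 1) * δ * δ * 2 := by linarith only [h1]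
    _ = δ * (2 * ((H : ℝ) + 1) * δ) := by ring

/-- `δ V ≤ 1` and `δ ≤ 1/4` for `δ = x^{−4ρ₁}`, `V = 4 log x`, once `4 log x ≤ x^{4ρ₁}` and
`log x ≥ 1`. [folklore] -/
theorem window_delta_le {x ρ₁ δ : ℝ} (hx0 : 0 < x) (hδ : δ = x ^ (-(4 * ρ₁)))
    (hlog4 : 4 * Real.log x ≤ x ^ (4 * ρ₁)) (hlog0 : 1 ≤ Real.log x) :
    δ * (4 * Real.log x) ≤ 1 ∧ δ ≤ 1 / 4 := by
  have hδpos : 0 < δ := by rw [hδ]; exact Real.rpow_pos_of_pos hx0 _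
  have hx4ρ₁ : x ^ (4 * ρ₁) * δ = 1 := by
    rw [hδ, Real.rpow_neg hx0.le, mul_inv_cancel₀ (Real.rpow_pos_of_pos hx0 _).ne']
  constructor
  · calc δ * (4 * Real.log x) ≤ δ * x ^ (4 * ρ₁) := mul_le_mul_of_nonneg_left hlog4 hδpos.le
      _ = 1 := by rw [mul_comm]; exact hx4ρ₁
  · have h4 : (4 : ℝ) ≤ x ^ (4 * ρ₁) := by linarith only [hlog0, hlog4]
    have : δ * 4 ≤ 1 :=
      (mul_le_mul_of_nonneg_left h4 hδpos.le).trans_eq (by rw [mul_comm]; exact hx4ρ₁)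
    rw [le_div_iff₀ (by norm_num : (0 : ℝ) < 4)]
    exact this

/-- The size of the error region: strips, far error and short rows together are
`≤ 83456 · x^{1−4ρ₁} log x`. [folklore] -/
theorem window_bracket_le {x δ M N P ρ₁ η : ℝ} (hx1 : 1 < x) (hP : P = M * N) (hPhi : P ≤ 256 * x)
    (hMη : M ≤ 256 * x ^ (1 - η)) (hρ₁η : 4 * ρ₁ ≤ η) (hδ : δ = x ^ (-(4 * ρ₁)))
    (hlog0 : 1 ≤ Real.log x) :
    (δ / 2) * (3 * M) * (3 * N) + (72 * (δ * (4 * Real.log x)) * P + 6 * M) ≤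
      83456 * (x ^ (1 - 4 * ρ₁) * Real.log x) := by
  have hx0 : 0 < x := by linarith
  have hδ0 : 0 ≤ δ := by rw [hδ]; exact (Real.rpow_pos_of_pos hx0 _).le
  have hxδ : x ^ (1 - 4 * ρ₁) = δ * x := by
    rw [hδ, sub_eq_add_neg, Real.rpow_add hx0, Real.rpow_one]; ring
  rw [hxδ]
  have hMδ : M ≤ 256 * (δ * x) := by
    rw [← hxδ]
    exact hMη.trans (mul_le_mul_of_nonneg_left
      (Real.rpow_le_rpow_of_exponent_le hx1.le (by linarith)) (by norm_num))
  have hδx0 : 0 ≤ δ * x := mul_nonneg hδ0 hx0.le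
  have hlogx0 : 0 ≤ Real.log x := by linarith
  have hδxl : δ * x ≤ δ * x * Real.log x := le_mul_of_one_le_right hδx0 hlog0
  have t1 : δ / 2 * (3 * M) * (3 * N) ≤ 1152 * (δ * x * Real.log x) := by
    have : 9 / 2 * δ * P ≤ 9 / 2 * δ * (256 * x) :=
      mul_le_mul_of_nonneg_left hPhi (mul_nonneg (by norm_num) hδ0)
    calc δ / 2 * (3 * M) * (3 * N) = 9 / 2 * δ * P := by rw [hP]; ring
      _ ≤ 1152 * (δ * x) := by linarith only [this]
      _ ≤ 1152 * (δ * x * Real.log x) := by linarith only [hδxl]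
  have t2 : 72 * (δ * (4 * Real.log x)) * P ≤ 73728 * (δ * x * Real.log x) := by
    have h0 : 0 ≤ 72 * (δ * (4 * Real.log x)) :=
      mul_nonneg (by norm_num) (mul_nonneg hδ0 (mul_nonneg (by norm_num) hlogx0))
    calc 72 * (δ * (4 * Real.log x)) * P ≤ 72 * (δ * (4 * Real.log x)) * (256 * x) :=
          mul_le_mul_of_nonneg_left hPhi h0
      _ = 73728 * (δ * x * Real.log x) := by ring
  have t3 : 6 * M ≤ 1536 * (δ * x * Real.log x) := by
    calc 6 * M ≤ 6 * (256 * (δ * x)) := mul_le_mul_of_nonneg_left hMδ (by norm_num)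
      _ = 1536 * (δ * x) := by ring
      _ ≤ 1536 * (δ * x * Real.log x) := by linarith only [hδxl]
  have t0 : 0 ≤ δ * x * Real.log x := mul_nonneg hδx0 hlogx0
  linarith only [t1, t2, t3, t0]

/-- The size of the trivial-bound constant `G = A² U`:
`A² U ≤ 3 · 1025 · Ca^{2K} Cd² · Rd x^{ρ₁}` for `A = Ca^K (512x)^ε`, `T = Cd x^ε`,
`U = Cd (1025x)^ε + 2 Rd T²`, `4ε = ρ₁ ≤ 1/48`. [folklore] -/
theorem window_G_le {x ε ρ₁ K Ca Cd Rd A T U : ℝ} (hx1 : 1 < x) (hε : 0 < ε) (hεdef : ε = ρ₁ / 4)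
    (hρ₁s : ρ₁ ≤ 1 / 48) (hCd1 : 1 ≤ Cd) (hRd1 : 1 ≤ Rd)
    (hA : A = Ca ^ K * (512 * x) ^ ε) (hT : T = Cd * x ^ ε)
    (hU : U = Cd * (1025 * x) ^ ε + 2 * Rd * T ^ 2) :
    A ^ 2 * U ≤ 3 * 1025 * (Ca ^ K) ^ 2 * Cd ^ 2 * (Rd * x ^ ρ₁) := by
  have hx0 : 0 < x := by linarith
  have hRd0 : 0 < Rd := by linarith
  have hCd0 : 0 ≤ Cd := by linarith
  have hU0 : 0 ≤ U := by rw [hU, hT]; positivity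
  set Z : ℝ := (1025 * x) ^ ε with hZ
  have hZ1 : 1 ≤ Z := Real.one_le_rpow (by linarith) hε.le
  have hZ0 : 0 ≤ Z := by linarith
  have h512 : (512 * x) ^ ε ≤ Z := Real.rpow_le_rpow (by linarith) (by linarith) hε.le
  have hxε : x ^ ε ≤ Z := Real.rpow_le_rpow hx0.le (by linarith) hε.le
  have hZ4 : Z ^ 4 ≤ 1025 * x ^ ρ₁ := by
    rw [hZ, ← Real.rpow_natCast, ← Real.rpow_mul (by linarith)]
    have : ε * ((4 : ℕ) : ℝ) = ρ₁ := by rw [hεdef]; push_cast; ring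
    rw [this, Real.mul_rpow (by norm_num) hx0.le]
    refine mul_le_mul_of_nonneg_right ?_ (Real.rpow_nonneg hx0.le _)
    calc (1025 : ℝ) ^ ρ₁ ≤ 1025 ^ (1 : ℝ) :=
          Real.rpow_le_rpow_of_exponent_le (by norm_num) (by linarith)
      _ = 1025 := Real.rpow_one _
  have hA2 : A ^ 2 ≤ (Ca ^ K) ^ 2 * Z ^ 2 := by
    rw [hA, mul_pow]
    exact mul_le_mul_of_nonneg_left
      (pow_le_pow_left₀ (Real.rpow_nonneg (by linarith) _) h512 2) (sq_nonneg _)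
  have hT2 : T ^ 2 ≤ Cd ^ 2 * Z ^ 2 := by
    rw [hT, mul_pow]
    exact mul_le_mul_of_nonneg_left (pow_le_pow_left₀ (Real.rpow_nonneg hx0.le _) hxε 2) (sq_nonneg _)
  have hZ2 : 0 ≤ Cd ^ 2 * Z ^ 2 := mul_nonneg (sq_nonneg _) (sq_nonneg _)
  have hU3 : U ≤ 3 * Rd * Cd ^ 2 * Z ^ 2 := by
    rw [hU]
    have h1 : Cd * Z ≤ Rd * Cd ^ 2 * Z ^ 2 := by
      have hCC : Cd ≤ Cd * Cd := le_mul_of_one_le_right hCd0 hCd1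
      have hZZ : Z ≤ Z * Z := le_mul_of_one_le_right hZ0 hZ1
      calc Cd * Z ≤ (Cd * Cd) * (Z * Z) := mul_le_mul hCC hZZ hZ0 (mul_nonneg hCd0 hCd0)
        _ = 1 * (Cd ^ 2 * Z ^ 2) := by ring
        _ ≤ Rd * (Cd ^ 2 * Z ^ 2) := mul_le_mul_of_nonneg_right hRd1 hZ2
        _ = Rd * Cd ^ 2 * Z ^ 2 := by ring
    have h2 : 2 * Rd * T ^ 2 ≤ 2 * Rd * (Cd ^ 2 * Z ^ 2) :=
      mul_le_mul_of_nonneg_left hT2 (mul_nonneg zero_le_two hRd0.le)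
    linarith only [h1, h2]
  have hR3 : 0 ≤ 3 * (Ca ^ K) ^ 2 * Cd ^ 2 * Rd :=
    mul_nonneg (mul_nonneg (mul_nonneg (by norm_num) (sq_nonneg _)) (sq_nonneg _)) hRd0.le
  calc A ^ 2 * U ≤ ((Ca ^ K) ^ 2 * Z ^ 2) * (3 * Rd * Cd ^ 2 * Z ^ 2) :=
        mul_le_mul hA2 hU3 hU0 (mul_nonneg (sq_nonneg _) (sq_nonneg _))
    _ = 3 * (Ca ^ K) ^ 2 * Cd ^ 2 * Rd * Z ^ 4 := by ring
    _ ≤ 3 * (Ca ^ K) ^ 2 * Cd ^ 2 * Rd * (1025 * x ^ ρ₁) := mul_le_mul_of_nonneg_left hZ4 hR3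
    _ = 3 * 1025 * (Ca ^ K) ^ 2 * Cd ^ 2 * (Rd * x ^ ρ₁) := by ring

/-- The logarithmic price of the separation is absorbed by `x^ρ`:
`2 + log(⌊x^{8ρ₁}⌋ + 1) ≤ 3 + log x ≤ x^ρ`. [folklore] -/
theorem window_log_price_le {x ρ ρ₁ : ℝ} {H : ℕ} (hx1 : 1 < x) (hH : H = ⌊x ^ (8 * ρ₁)⌋₊)
    (hρ₁pos : 0 < ρ₁) (hρ₁s : ρ₁ ≤ 1 / 48) (hlog0 : 1 ≤ Real.log x)
    (hlogρ : 3 + Real.log x ≤ x ^ ρ) : 2 + Real.log ((H : ℝ) + 1) ≤ x ^ ρ := by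
  have hx0 : 0 < x := by linarith
  have hH0 : (H : ℝ) ≤ x ^ (8 * ρ₁) := by rw [hH]; exact Nat.floor_le (Real.rpow_nonneg hx0.le _)
  have hx8 : 1 ≤ x ^ (8 * ρ₁) := Real.one_le_rpow hx1.le (by linarith)
  have hx8' : 0 < x ^ (8 * ρ₁) := by linarith
  have hH0' : 0 < (H : ℝ) + 1 := by positivity
  have h1 : Real.log ((H : ℝ) + 1) ≤ Real.log (2 * x ^ (8 * ρ₁)) :=
    Real.log_le_log hH0' (by linarith)
  have h2 : Real.log (2 * x ^ (8 * ρ₁)) = Real.log 2 + 8 * ρ₁ * Real.log x := by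
    rw [Real.log_mul (by norm_num) hx8'.ne', Real.log_rpow hx0]
  have h3 : Real.log 2 ≤ 1 := by
    have := Real.log_le_sub_one_of_pos (by norm_num : (0 : ℝ) < 2); linarith
  have h4 : 8 * ρ₁ * Real.log x ≤ Real.log x := by nlinarith
  linarith

/-- The main part: `L · C₁' x^{1+4ρ}/Rd ≤ C₁' x^{1+5ρ}/Rd` once `L ≤ x^ρ`. [folklore] -/
theorem window_main_part_le {x ρ C₁' Rd L : ℝ} (hx0 : 0 < x) (hC : 0 ≤ C₁') (hRd : 0 < Rd)
    (hL : L ≤ x ^ ρ) : L * (C₁' * x ^ (1 + 4 * ρ) / Rd) ≤ C₁' * x ^ (1 + 5 * ρ) / Rd := by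
  have h0 : 0 ≤ C₁' * x ^ (1 + 4 * ρ) / Rd :=
    div_nonneg (mul_nonneg hC (Real.rpow_nonneg hx0.le _)) hRd.le
  calc L * (C₁' * x ^ (1 + 4 * ρ) / Rd) ≤ x ^ ρ * (C₁' * x ^ (1 + 4 * ρ) / Rd) :=
        mul_le_mul_of_nonneg_right hL h0
    _ = C₁' * (x ^ ρ * x ^ (1 + 4 * ρ)) / Rd := by ring
    _ = C₁' * x ^ (1 + 5 * ρ) / Rd := by
        rw [← Real.rpow_add hx0, show ρ + (1 + 4 * ρ) = 1 + 5 * ρ by ring]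

/-- The power bookkeeping of the error:
`Rd x^{ρ₁} x^{2ρ} x^{1−4ρ₁} log x ≤ x^{1+5ρ}/Rd` when `Rd, log x ≤ x^{ρ₁}`. [folklore] -/
theorem window_power_bookkeeping {x ρ ρ₁ Rd : ℝ} (hx1 : 1 < x) (hρ : 0 < ρ) (hRd0 : 0 < Rd)
    (hRdx : Rd ≤ x ^ ρ₁) (hlog1 : Real.log x ≤ x ^ ρ₁) (hlog0 : 1 ≤ Real.log x) :
    Rd * x ^ ρ₁ * (x ^ ρ * x ^ ρ) * (x ^ (1 - 4 * ρ₁) * Real.log x) ≤ x ^ (1 + 5 * ρ) / Rd := by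
  have hx0 : 0 < x := by linarith
  rw [le_div_iff₀ hRd0]
  have hxρ₁ : 0 ≤ x ^ ρ₁ := Real.rpow_nonneg hx0.le _
  have hxρ : 0 ≤ x ^ ρ := Real.rpow_nonneg hx0.le _
  have hxδ : 0 ≤ x ^ (1 - 4 * ρ₁) := Real.rpow_nonneg hx0.le _
  have hRR : Rd * Rd ≤ x ^ ρ₁ * x ^ ρ₁ := mul_le_mul hRdx hRdx hRd0.le hxρ₁
  have hexp : x ^ ρ₁ * x ^ ρ₁ * x ^ ρ₁ * (x ^ ρ * x ^ ρ) * x ^ (1 - 4 * ρ₁) * x ^ ρ₁ =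
      x ^ (1 + 2 * ρ) := by
    simp only [← Real.rpow_add hx0]
    congr 1
    ring
  have hW0 : 0 ≤ x ^ ρ₁ * (x ^ ρ * x ^ ρ) * x ^ (1 - 4 * ρ₁) :=
    mul_nonneg (mul_nonneg hxρ₁ (mul_nonneg hxρ hxρ)) hxδ
  calc Rd * x ^ ρ₁ * (x ^ ρ * x ^ ρ) * (x ^ (1 - 4 * ρ₁) * Real.log x) * Rd
      = (Rd * Rd) * (x ^ ρ₁ * (x ^ ρ * x ^ ρ) * x ^ (1 - 4 * ρ₁)) * Real.log x := by ring
    _ ≤ (x ^ ρ₁ * x ^ ρ₁) * (x ^ ρ₁ * (x ^ ρ * x ^ ρ) * x ^ (1 - 4 * ρ₁)) * x ^ ρ₁ :=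
        mul_le_mul (mul_le_mul_of_nonneg_right hRR hW0) hlog1 (by linarith)
          (mul_nonneg (mul_nonneg hxρ₁ hxρ₁) hW0)
    _ = x ^ ρ₁ * x ^ ρ₁ * x ^ ρ₁ * (x ^ ρ * x ^ ρ) * x ^ (1 - 4 * ρ₁) * x ^ ρ₁ := by ring
    _ = x ^ (1 + 2 * ρ) := hexp
    _ ≤ x ^ (1 + 5 * ρ) := Real.rpow_le_rpow_of_exponent_le hx1.le (by linarith)

/-! ### §5 Eventual inequalities -/

/-- The eventual inequalities in `x` used by the window step, packaged: for `0 < ρ`, `0 < ρ₁ < 1`,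
eventually `x ≥ x₁`, `x ≥ 1024`, `2(|c|+1) ≤ x^{1−ρ₁}`, `|c| ≤ x`, `3 + log x ≤ x^ρ`,
`4 log x ≤ x^{4ρ₁}`, `log x ≤ x^{ρ₁}`, `1 ≤ log x`. [folklore] -/
theorem window_eventually (x₁ : ℝ) (c : ℤ) {ρ ρ₁ : ℝ} (hρ : 0 < ρ) (hρ₁ : 0 < ρ₁) (hρ₁1 : ρ₁ < 1) :
    ∀ᶠ x : ℝ in Filter.atTop, x₁ ≤ x ∧ 1024 ≤ x ∧ 2 * ((|c| : ℝ) + 1) ≤ x ^ (1 - ρ₁) ∧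
      (|c| : ℝ) ≤ x ∧ 3 + Real.log x ≤ x ^ ρ ∧ 4 * Real.log x ≤ x ^ (4 * ρ₁) ∧
      Real.log x ≤ x ^ ρ₁ ∧ 1 ≤ Real.log x := by
  have hlog : ∀ {r : ℝ}, 0 < r → ∀ {a b : ℝ}, 0 < a →
      ∀ᶠ x : ℝ in Filter.atTop, b + a * Real.log x ≤ x ^ r := by
    intro r hr a b ha
    have h1 : ∀ᶠ x : ℝ in Filter.atTop, Real.log x ≤ x ^ (r / 2) / (r / 2) :=
      (Filter.eventually_ge_atTop 0).mono fun x hx => Real.log_le_rpow_div hx (by positivity)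
    have h2 : ∀ᶠ x : ℝ in Filter.atTop, a / (r / 2) + |b| ≤ x ^ (r / 2) :=
      (tendsto_rpow_atTop (by positivity)).eventually_ge_atTop _
    have h3 : ∀ᶠ x : ℝ in Filter.atTop, (1 : ℝ) ≤ x ^ (r / 2) :=
      (tendsto_rpow_atTop (by positivity)).eventually_ge_atTop _
    filter_upwards [h1, h2, h3, Filter.eventually_gt_atTop 0] with x hx1 hx2 hx3 hx0
    have hsq : x ^ (r / 2) * x ^ (r / 2) = x ^ r := by
      rw [← Real.rpow_add hx0]; ring_nf
    have hxr0 : 0 ≤ x ^ (r / 2) := Real.rpow_nonneg hx0.le _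
    have hlx : a * Real.log x ≤ a * (x ^ (r / 2) / (r / 2)) := mul_le_mul_of_nonneg_left hx1 ha.le
    have e : a * (x ^ (r / 2) / (r / 2)) = a / (r / 2) * x ^ (r / 2) := by ring
    have hbabs : b ≤ |b| := le_abs_self b
    have hb1 : |b| ≤ |b| * x ^ (r / 2) := le_mul_of_one_le_right (abs_nonneg b) hx3
    calc b + a * Real.log x ≤ |b| * x ^ (r / 2) + a / (r / 2) * x ^ (r / 2) := by linarith
      _ = (a / (r / 2) + |b|) * x ^ (r / 2) := by ring
      _ ≤ x ^ (r / 2) * x ^ (r / 2) := mul_le_mul_of_nonneg_right hx2 hxr0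
      _ = x ^ r := hsq
  have e1 := Filter.eventually_ge_atTop x₁
  have e2 := Filter.eventually_ge_atTop (1024 : ℝ)
  have e3 : ∀ᶠ x : ℝ in Filter.atTop, 2 * ((|c| : ℝ) + 1) ≤ x ^ (1 - ρ₁) :=
    (tendsto_rpow_atTop (by linarith)).eventually_ge_atTop _
  have e4 := Filter.eventually_ge_atTop ((|c| : ℝ))
  have e5 : ∀ᶠ x : ℝ in Filter.atTop, 3 + 1 * Real.log x ≤ x ^ ρ := hlog hρ one_pos
  have e6 : ∀ᶠ x : ℝ in Filter.atTop, 0 + 4 * Real.log x ≤ x ^ (4 * ρ₁) :=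
    hlog (by positivity) (by norm_num)
  have e7 : ∀ᶠ x : ℝ in Filter.atTop, 0 + 1 * Real.log x ≤ x ^ ρ₁ := hlog hρ₁ one_pos
  have e8 : ∀ᶠ x : ℝ in Filter.atTop, (1 : ℝ) ≤ Real.log x :=
    Real.tendsto_log_atTop.eventually_ge_atTop _
  filter_upwards [e1, e2, e3, e4, e5, e6, e7, e8] with x h1 h2 h3 h4 h5 h6 h7 h8
  exact ⟨h1, h2, h3, h4, by linarith, by linarith, by linarith, h8⟩

/-! ### Anchor -/

/-- Anchor of this support file (numerical lemmas) in the registered skeleton of `stmt-Parity-14272`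
(line `peel-to-drappeau`, stub `stub_window`, window chain file 1/2). [this line] -/
theorem windowChain1_anchor : True := trivial

end Summit.Parity.GeneralizedHardyLittlewood.Cruxes.TypeI2Dilated.PeelToDrappeau

end
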